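import Literature.NumberTheory.Automorphic.CongruenceSubgroupPropertySL2AwaySymbolMul
import Literature.NumberTheory.Automorphic.CongruenceSubgroupPropertySL2AwayMennickeTrivial
import Literature.NumberTheory.Automorphic.CongruenceSubgroupPropertySL2Away
import HarnessLib

/-!
# Serre's congruence subgroup property for `SL₂(ℤ[1/m])` — proofs, A-VII: Vaserstein's theorem
# `G((q), A) = E((q), A)` over `A = ℤ[1/m]` and the DISCHARGE of
# `SerreSL2Congruence1970_congruenceSubgroupProperty_away`

Topic `Literature/NumberTheory/Automorphic`; namespace `Literature.NumberTheory.Automorphic`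
(sub-namespace `SL2Rel.Away`).  Everything here is PROVED; no definitions, no named facts.

This is the `A = ℤ[1/m] = Localization.Away (m : ℤ)` (`m ≥ 2`) counterpart of
`CongruenceSubgroupPropertySL2Holds.lean` (there `A = 𝓞_K`), assembling the port
`CongruenceSubgroupPropertySL2Away{Arith,Lemma4,Lemma2,Symbol,SymbolMul,MennickeTrivial}.lean`:

* `SL2Rel.Away.sym_eq_one_of_row` — for `q ≠ 0` the symbol `[b over a] ∈ G((q), A) ⧸ ncl E((q), A)`
  is a Mennicke symbol on `W_{(q)}` (MS1 = Liehl (6), MS2 = Liehl (7) = `SL2Rel.Away.sym_mul_right`),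
  hence trivial by Bass–Milnor–Serre Thm. 3.6 over `ℚ` (`SerreSL2.MennickeSymbol.sym_eq_one_away`);
* `SL2Rel.Away.relG_le_relE_span_singleton` — **Vaserstein's Theorem** for the pair `((q), A)`:
  `G((q), A) ≤ E((q), A)` (`q ≠ 0`), and `relG_le_relE_of_ne_bot` for every ideal `𝔮 ≠ 0` (all ideals
  of `ℤ[1/m]` are principal); the Weyl-transposed pair `relG_top_le_relE_top` : `G(A, (q)) ≤ E(A, (q))`;
* the two binder shapes consumed downstream, input-free:
  `SL2Rel.Away.relG_le_relE_span_natCast : ∀ m ≥ 2, ∀ e ≠ 0, G((e), A) ≤ E((e), A)` (the hypothesis of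
  `congruenceSubgroupProperty_away_of_relG_le_relE`) and
  `SL2Rel.Away.relG_top_span_natCast_le_relE : ∀ m ≥ 2, ∀ N ≠ 0, G(A, (N)) ≤ E(A, (N))`;
* `SerreSL2Congruence1970_congruenceSubgroupProperty_away_holds` — the DISCHARGE of the named fact
  `SerreSL2Congruence1970_congruenceSubgroupProperty_away` (Serre 1970, §2.6 Théorème 2 (b) / Cor. of
  Thm. 3 for `K = ℚ`, `|S| ≥ 2`): every finite-index subgroup of `SL₂(ℤ[1/m])`, `m ≥ 2`, is a congruence
  subgroup — by the reduction `congruenceSubgroupProperty_away_of_relG_le_relE` (file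
  `CongruenceSubgroupPropertySL2Away.lean`) and Vaserstein's theorem above.  No Moore theory, no
  bounded generation (Morris), no Mennicke 1967: the Moore-free road Vaserstein 1972 + Liehl 1981 +
  BMS Thm. 3.6 with quadratic reciprocity over `ℚ`.

## References

* [Vaserstein1972SL2] L. N. Vaserstein, Math. USSR-Sb. 18 (1972) 321–332, Theorem (p. 313 of the
  Russian original), Lemmas 1–5.
* [Liehl1981SL2Orders] B. Liehl, J. reine angew. Math. 323 (1981) 153–171, §3 (6)–(14).
* [BassMilnorSerre1967] H. Bass, J. Milnor, J.-P. Serre, Publ. Math. IHES 33 (1967), Ch. I Thm. 3.6.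
* [SerreSL2Congruence1970] J.-P. Serre, Ann. of Math. 92 (1970) 489–527, §2.6 Théorème 2 (b),
  Corollaire du Théorème 3.
-/

open Matrix MatrixGroups

namespace Literature.NumberTheory.Automorphic

namespace SL2Rel

/-! ### Transposition by the Weyl element: `G(I₂, I₁) ≤ E(I₂, I₁)` from `G(I₁, I₂) ≤ E(I₁, I₂)` -/

section CommRing

variable {R : Type*} [CommRing R]

/-- `w E(I₁, I₂) w⁻¹ ⊆ E(I₂, I₁)` for the Weyl element `w`. [folklore] -/
private theorem weylElt_conj_mem_relE_swap {I₁ I₂ : Ideal R} {E : SL(2, R)} (hE : E ∈ relE I₁ I₂) :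
    (weylElt : SL(2, R)) * E * weylElt⁻¹ ∈ relE I₂ I₁ := by
  have h : (relE I₁ I₂).map (MulAut.conj (weylElt : SL(2, R))).toMonoidHom ≤ relE I₂ I₁ := by
    rw [relE, MonoidHom.map_closure, Subgroup.closure_le]
    rintro _ ⟨M, hM | hM, rfl⟩
    · obtain ⟨x, hx, rfl⟩ := hM
      rw [MulEquiv.coe_toMonoidHom, MulAut.conj_apply, weylElt_mul_e12_mul_inv]
      exact e21_mem_relE (I₁.neg_mem hx)
    · obtain ⟨y, hy, rfl⟩ := hM
      rw [MulEquiv.coe_toMonoidHom, MulAut.conj_apply, weylElt_mul_e21_mul_inv]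
      exact e12_mem_relE (I₂.neg_mem hy)
  exact h (Subgroup.mem_map_of_mem _ hE)

/-- `w⁻¹ G(I₂, I₁) w ⊆ G(I₁, I₂)` for the Weyl element `w`. [folklore] -/
private theorem weylElt_inv_conj_mem_relG_swap {I₁ I₂ : Ideal R} {M : SL(2, R)}
    (hM : M ∈ relG I₂ I₁) : (weylElt : SL(2, R))⁻¹ * M * weylElt ∈ relG I₁ I₂ := by
  obtain ⟨h01, h10, h00, h11⟩ := mem_relG.1 hM
  obtain ⟨e00, e01, e10, e11⟩ := weylElt_inv_mul_mul_apply M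
  refine mem_relG.2 ⟨?_, ?_, ?_, ?_⟩
  · rw [e01]; exact I₁.neg_mem h10
  · rw [e10]; exact I₂.neg_mem h01
  · rw [e00, mul_comm]; exact h11
  · rw [e11, mul_comm]; exact h00

/-- `G(I₂, I₁) ≤ E(I₂, I₁)` follows from `G(I₁, I₂) ≤ E(I₁, I₂)` (conjugate by the Weyl element:
`M = w (w⁻¹ M w) w⁻¹`). [folklore] -/
private theorem relG_le_relE_swap {I₁ I₂ : Ideal R} (h : relG I₁ I₂ ≤ relE I₁ I₂) :
    relG I₂ I₁ ≤ relE I₂ I₁ := by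
  intro M hM
  have h1 := weylElt_conj_mem_relE_swap (h (weylElt_inv_conj_mem_relG_swap hM))
  have e : (weylElt : SL(2, R)) * ((weylElt : SL(2, R))⁻¹ * M * weylElt) * weylElt⁻¹ = M := by group
  rwa [e] at h1

end CommRing

namespace Away

variable {m : ℕ}

/-- **Vaserstein's Lemma 3 + BMS Thm. 3.6 over `A = ℤ[1/m]`, `m ≥ 2`**: for `𝔮 = (q) ≠ 0` the symbol
`[b over a] ∈ G(𝔮, A) ⧸ ncl E(𝔮, A)` is a Mennicke symbol on `W_𝔮` (MS1 = Liehl (6), MS2 = Liehl (7)),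
hence trivial: `[b over a] = 1` for all `(a, b) ∈ W_𝔮`.
[cite: Vaserstein1972SL2, Lemma 3; BassMilnorSerre1967, Ch. I Thm. 3.6] -/
theorem sym_eq_one_of_row (hm : 2 ≤ m) {q : Localization.Away (m : ℤ)} (hq : q ≠ 0)
    {a b : Localization.Away (m : ℤ)} (ha : a - 1 ∈ Ideal.span {q}) (hb : b ∈ Ideal.span {q})
    (hab : IsCoprime a b) : sym (Ideal.span {q}) a b = 1 := by
  have h𝔮 : Ideal.span {q} ≠ (⊥ : Ideal (Localization.Away (m : ℤ))) := by
    rwa [Ne, Ideal.span_singleton_eq_bot]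
  -- the symbol packaged as a Mennicke symbol on `W_𝔮` (BMS Def. 2.5)
  let M : SerreSL2.MennickeSymbol (Ideal.span {q}) (SymbGroup (Ideal.span {q})) :=
    { sym := sym (Ideal.span {q})
      sym_one_zero := sym_one_zero _
      ms1_right := fun _ _ _ ha hb hab ht ↦ sym_add_mul_right ha hb hab ht
      ms1_left := fun _ _ t ha hb hab ↦ sym_add_mul_left ha hb hab t
      ms2 := fun _ _ _ ha hb₁ hb₂ h₁ h₂ ↦ sym_mul_right hm h𝔮 ha hb₁ hb₂ h₁ h₂ }
  exact M.sym_eq_one_away hm ha hb hab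

/-- **Vaserstein's Theorem** (`G(I₁, I₂) = E(I₁, I₂)`) for the pair `((q), A)`, `A = ℤ[1/m]`, `m ≥ 2`,
`q ≠ 0`: `G((q), A) ≤ E((q), A)` — the class of `α ∈ G(𝔮, A)` in `G(𝔮, A) ⧸ ncl E(𝔮, A)` is the
(trivial) symbol of its first row, and `ncl E(𝔮, A) = E(𝔮, A)` by (5).
[cite: Vaserstein1972SL2, Theorem, p. 313] -/
theorem relG_le_relE_span_singleton (hm : 2 ≤ m) {q : Localization.Away (m : ℤ)} (hq : q ≠ 0) :
    relG (Ideal.span {q}) ⊤ ≤ relE (Ideal.span {q}) (⊤ : Ideal (Localization.Away (m : ℤ))) := by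
  intro M hM
  have h𝔮 : Ideal.span {q} ≠ (⊥ : Ideal (Localization.Away (m : ℤ))) := by
    rwa [Ne, Ideal.span_singleton_eq_bot]
  obtain ⟨h01, -, h00, -⟩ := mem_relG.1 hM
  rw [Ideal.mul_top] at h00
  have hab : IsCoprime (M 0 0) (M 0 1) := by
    refine ⟨M 1 1, -M 1 0, ?_⟩
    have hdet := Matrix.det_fin_two (M : Matrix (Fin 2) (Fin 2) (Localization.Away (m : ℤ)))
    rw [M.det_coe] at hdet
    linear_combination -hdet
  set α : relG (Ideal.span {q}) ⊤ := ⟨M, hM⟩ with hα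
  have hsym : sym (Ideal.span {q}) (M 0 0) (M 0 1) = (α : SymbGroup (Ideal.span {q})) :=
    sym_eq_mk α rfl rfl
  have h1 : (α : SymbGroup (Ideal.span {q})) = ((1 : relG (Ideal.span {q}) ⊤) : SymbGroup _) := by
    rw [← hsym, sym_eq_one_of_row hm hq h00 h01 hab, QuotientGroup.mk_one]
  rw [mk_eq_mk_iff hm h𝔮] at h1
  simpa [hα] using h1

/-- **Vaserstein's Theorem for every non-zero ideal of `ℤ[1/m]`**, `m ≥ 2`: `G(𝔮, A) ≤ E(𝔮, A)` —
every ideal of `ℤ[1/m]` is principal, `𝔮 = (B)` with `B ≥ 1` prime to `m`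
(`SerreSL2.Away.exists_coprime_eq_span`). [cite: Vaserstein1972SL2, Theorem, p. 313] -/
theorem relG_le_relE_of_ne_bot (hm : 2 ≤ m) {𝔮 : Ideal (Localization.Away (m : ℤ))} (h𝔮 : 𝔮 ≠ ⊥) :
    relG 𝔮 ⊤ ≤ relE 𝔮 (⊤ : Ideal (Localization.Away (m : ℤ))) := by
  obtain ⟨B, hB, -, rfl⟩ := SerreSL2.Away.exists_coprime_eq_span (show m ≠ 0 by omega) h𝔮
  exact relG_le_relE_span_singleton hm (natCast_ne_zero_away (by omega) hB.ne')

/-- **Vaserstein's Theorem, transposed pair `(A, (q))`** over `A = ℤ[1/m]`, `m ≥ 2`, `q ≠ 0`: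
`G(A, (q)) ≤ E(A, (q))` — conjugation by the Weyl element swaps the roles of `I₁` and `I₂` in both
`G(I₁, I₂)` and `E(I₁, I₂)`. [cite: Vaserstein1972SL2, Theorem, p. 313] -/
theorem relG_top_le_relE_top (hm : 2 ≤ m) {q : Localization.Away (m : ℤ)} (hq : q ≠ 0) :
    relG (⊤ : Ideal (Localization.Away (m : ℤ))) (Ideal.span {q}) ≤ relE ⊤ (Ideal.span {q}) :=
  relG_le_relE_swap (relG_le_relE_span_singleton hm hq)

/-- **Vaserstein's Theorem over `ℤ[1/m]` in the binder shape of the reduction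
`congruenceSubgroupProperty_away_of_relG_le_relE`** (and of stub (V) of the `X10b` μ-line): for all
`m ≥ 2` and `e ≠ 0`, `G((e), ℤ[1/m]) ≤ E((e), ℤ[1/m])`. [cite: Vaserstein1972SL2, Theorem, p. 313] -/
theorem relG_le_relE_span_natCast : ∀ (m : ℕ), 2 ≤ m → ∀ e : ℕ, e ≠ 0 →
    relG (Ideal.span {(e : Localization.Away (m : ℤ))}) ⊤ ≤
      relE (Ideal.span {(e : Localization.Away (m : ℤ))}) (⊤ : Ideal (Localization.Away (m : ℤ))) :=
  fun _m hm _e he ↦ relG_le_relE_span_singleton hm (natCast_ne_zero_away (by omega) he)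

/-- **Vaserstein's Theorem over `ℤ[1/m]`, transposed pair, natural-number level**: for all `m ≥ 2`
and `N ≠ 0`, `G(ℤ[1/m], (N)) ≤ E(ℤ[1/m], (N))` (the shape `RelGLeRelE p N` of THEOREM B's
`conjSpanGenAll_of_relGLeRelE_all`, for every `m`, prime or not). [cite: Vaserstein1972SL2, Theorem, p. 313] -/
theorem relG_top_span_natCast_le_relE : ∀ (m : ℕ), 2 ≤ m → ∀ N : ℕ, N ≠ 0 →
    relG (⊤ : Ideal (Localization.Away (m : ℤ))) (Ideal.span {(N : Localization.Away (m : ℤ))}) ≤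
      relE ⊤ (Ideal.span {(N : Localization.Away (m : ℤ))}) :=
  fun _m hm _N hN ↦ relG_top_le_relE_top hm (natCast_ne_zero_away (by omega) hN)

end Away

end SL2Rel

/-! ### The discharge -/

/-- **Serre's congruence subgroup property for `SL₂(ℤ[1/m])`, `m ≥ 2` — PROVED**: every subgroup of
finite index of `SL₂(ℤ[1/m])` contains a principal congruence subgroup `Γ_𝔮`, `𝔮 ≠ 0`.  This
discharges the named fact `SerreSL2Congruence1970_congruenceSubgroupProperty_away` (net debt −1) by the
reduction `congruenceSubgroupProperty_away_of_relG_le_relE` and Vaserstein's theorem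
`SL2Rel.Away.relG_le_relE_span_natCast`.
[cite: SerreSL2Congruence1970, §2.6 Théorème 2 (b), Corollaire du Théorème 3 (`K = ℚ`, `|S| ≥ 2`)] -/
theorem SerreSL2Congruence1970_congruenceSubgroupProperty_away_holds :
    SerreSL2Congruence1970_congruenceSubgroupProperty_away :=
  congruenceSubgroupProperty_away_of_relG_le_relE SL2Rel.Away.relG_le_relE_span_natCast

end Literature.NumberTheory.Automorphic
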